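import Summits.CriticalPhenomena.PercolationContinuityZ3.Theorems.PercNearOneGluingNoHeavyLowerTailSunflowerPurePayer
import HarnessLib

/-!
# `NoHeavyLowerTail` (crux stmt-CriticalPhenomena-4575), abstract sunflower cubic: the conjecture `PurePayer` is FALSE — the CYCLIC STAR on nine
# coordinates needs BOTH spectator classes (`3·SA − Ntri = −6`, `3·SB − Ntri = −324`, `ZH = 972 > 0`)

Support file (seat `prim-ineq-prove-1` gen 29; `--supports stmt-CriticalPhenomena-4575`).  COMPUTATIONAL: the three partition counts of the explicit
nine-coordinate witness are evaluated by `native_decide` (262,144 block pairs; a kernel `decide` is out of reach), everything else is kernel-checked.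
Memo: run/shared/lean/prim/prim-ineq-prove-1/FINDING-PAYER-prove1-g29.md §7 (witness found by the ttrl census lane cp-payer, request l.1029, and verified by
four independent code paths).

THE WITNESS (cyclic star `CS(3,3,3)`).  Ground set `Fin 9` in three groups `G_t = {3t, 3t+1, 3t+2}`; for `i ∈ Fin 3` let
`U_i(S) :⟺ (S meets G_{i+1} and S meets G_{i+2}) or G_{i+1} ⊆ S` (indices mod 3; an up-set), and take the θ-pullback sunflower
`V_i = {S : U_i(S) ∨ (U_{i+1}(S) ∧ U_{i+2}(S))}` (kernel = at least two `U`'s, petal `i` = exactly `U_i`).  Then `SA = 432`, `SB = 326`, `Ntri = 1302`, so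
`3·max(SA, SB) = 1296 < Ntri`: Lemma A fails by one rainbow class (the partition `(G₀,G₁,G₂)` itself, created by the cyclic full-group generators) and
Lemma B fails too, while `ZH = 3(SA + SB) − Ntri = 972 ≥ 0` — the partition lemma `PartitionLemmaH` is untouched; only the dichotomy dies.
The law-level form `max(a,b)·(ab − e₂) ≥ e₃` is NOT refuted by this family (memo §7).
-/

namespace Summit.CriticalPhenomena.PercolationContinuityZ3.Theorems.SunflowerPartition

open Finset

namespace CyclicStar

/-- `S` meets group `t` (`t ∈ Fin 3`, group `t` = `{x : x / 3 = t}`). [this work] -/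
def hits (t : Fin 3) (S : Finset (Fin 9)) : Prop := ∃ x ∈ S, x.val / 3 = t.val

/-- `S` contains all of group `t`. [this work] -/
def full (t : Fin 3) (S : Finset (Fin 9)) : Prop := ∀ x : Fin 9, x.val / 3 = t.val → x ∈ S

/-- `hits` is decidable. [this work] -/
instance (t : Fin 3) (S : Finset (Fin 9)) : Decidable (hits t S) := by unfold hits; infer_instance
/-- `full` is decidable. [this work] -/
instance (t : Fin 3) (S : Finset (Fin 9)) : Decidable (full t S) := by unfold full; infer_instance

/-- The generator condition `U_i`: both other groups are met, or the next group is contained. [this work] -/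
def U (i : Fin 3) (S : Finset (Fin 9)) : Prop := (hits (i + 1) S ∧ hits (i + 2) S) ∨ full (i + 1) S

/-- `U_i` is decidable. [this work] -/
instance (i : Fin 3) (S : Finset (Fin 9)) : Decidable (U i S) := by unfold U; infer_instance

/-- `hits` is monotone. [this work] -/
theorem hits_mono {t : Fin 3} {S T : Finset (Fin 9)} (h : S ⊆ T) (hS : hits t S) : hits t T := by
  obtain ⟨x, hx, hxt⟩ := hS; exact ⟨x, h hx, hxt⟩

/-- `full` is monotone. [this work] -/
theorem full_mono {t : Fin 3} {S T : Finset (Fin 9)} (h : S ⊆ T) (hS : full t S) : full t T :=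
  fun x hx => h (hS x hx)

/-- `U_i` is monotone. [this work] -/
theorem U_mono {i : Fin 3} {S T : Finset (Fin 9)} (h : S ⊆ T) (hS : U i S) : U i T := by
  rcases hS with ⟨h1, h2⟩ | h3
  · exact Or.inl ⟨hits_mono h h1, hits_mono h h2⟩
  · exact Or.inr (full_mono h h3)

/-- The fast label of the cyclic star (`⊤` iff at least two `U`'s, petal `i` iff exactly `U_i`, else `0`). [this work] -/
def lab9 (S : Finset (Fin 9)) : Fin 5 :=
  if (U 0 S ∧ U 1 S) ∨ (U 0 S ∧ U 2 S) ∨ (U 1 S ∧ U 2 S) then 4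
  else if U 0 S then 1 else if U 1 S then 2 else if U 2 S then 3 else 0

/-- The θ-pullback up-set `V_i = U_i ∪ (U_{i+1} ∩ U_{i+2})`. [this work] -/
def Vset (i : Fin 3) : Finset (Finset (Fin 9)) := univ.filter fun S => U i S ∨ (U (i + 1) S ∧ U (i + 2) S)

/-- Membership in `Vset i`. [this work] -/
theorem mem_Vset (i : Fin 3) (S : Finset (Fin 9)) : S ∈ Vset i ↔ U i S ∨ (U (i + 1) S ∧ U (i + 2) S) := by
  unfold Vset; rw [mem_filter]; simp only [mem_univ, true_and]

/-- **The cyclic star `CS(3,3,3)`** as a `Sunflower (Fin 9)`. [this work] -/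
def cs : Sunflower (Fin 9) where
  V := Vset
  upper i := by
    intro S T hST hS
    rw [Finset.mem_coe, mem_Vset] at hS ⊢
    rcases hS with h | ⟨h1, h2⟩
    · exact Or.inl (U_mono hST h)
    · exact Or.inr ⟨U_mono hST h1, U_mono hST h2⟩
  inter_eq i j hij := by
    ext S
    simp only [mem_inter, mem_Vset]
    have key : ∀ i j : Fin 3, i ≠ j →
        ((U i S ∨ U (i + 1) S ∧ U (i + 2) S) ∧ (U j S ∨ U (j + 1) S ∧ U (j + 2) S) ↔
          (U 0 S ∧ U 1 S) ∨ (U 0 S ∧ U 2 S) ∨ (U 1 S ∧ U 2 S)) := by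
      intro i j hij
      fin_cases i <;> fin_cases j <;> simp at hij ⊢ <;> tauto
    rw [key i j hij, key 0 1 (by decide)]

/-- The labelling of `cs` is the fast label `lab9`. [this work] -/
theorem lab_cs (S : Finset (Fin 9)) : cs.lab S = lab9 S := by
  have hA : S ∈ cs.A ↔ (U 0 S ∧ U 1 S) ∨ (U 0 S ∧ U 2 S) ∨ (U 1 S ∧ U 2 S) := by
    unfold Sunflower.A
    show S ∈ Vset 0 ∩ Vset 1 ↔ _
    rw [mem_inter, mem_Vset, mem_Vset]
    simp only [show (0 : Fin 3) + 1 = 1 from rfl, show (0 : Fin 3) + 2 = 2 from rfl, show (1 : Fin 3) + 1 = 2 from rfl,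
      show (1 : Fin 3) + 2 = 0 from rfl]
    tauto
  have h0 : S ∈ cs.V 0 ↔ U 0 S ∨ (U 1 S ∧ U 2 S) := mem_Vset 0 S
  have h1 : S ∈ cs.V 1 ↔ U 1 S ∨ (U 2 S ∧ U 0 S) := mem_Vset 1 S
  have h2 : S ∈ cs.V 2 ↔ U 2 S ∨ (U 0 S ∧ U 1 S) := mem_Vset 2 S
  unfold Sunflower.lab lab9
  by_cases u0 : U 0 S <;> by_cases u1 : U 1 S <;> by_cases u2 : U 2 S <;> simp [hA, h0, h1, h2, u0, u1, u2]

/-- `SA` of the cyclic star, in fast-label form. [this work] -/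
theorem SA_cs_eq : cs.SA = ∑ q ∈ parts (Fin 9),
    (if lab9 q.1 = 4 then (1 : ℤ) else 0) * kk (lab9 q.2) (lab9 (q.1 ∪ q.2)ᶜ) := by
  unfold Sunflower.SA Sunflower.Sw
  simp_rw [lab_cs]

/-- `SB` of the cyclic star, in fast-label form. [this work] -/
theorem SB_cs_eq : cs.SB = ∑ q ∈ parts (Fin 9),
    (if lab9 q.1 = 0 then (1 : ℤ) else 0) * kk (lab9 q.2) (lab9 (q.1 ∪ q.2)ᶜ) := by
  unfold Sunflower.SB Sunflower.Sw
  simp_rw [lab_cs]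

/-- `Ntri` of the cyclic star, in fast-label form. [this work] -/
theorem Ntri_cs_eq : cs.Ntri = ∑ q ∈ parts (Fin 9), triP (lab9 q.1) (lab9 q.2) (lab9 (q.1 ∪ q.2)ᶜ) := by
  unfold Sunflower.Ntri
  simp_rw [lab_cs]

/-- `SA(cs) = 432` (native evaluation). [this work] -/
theorem SA_cs : cs.SA = 432 := by
  rw [SA_cs_eq]; native_decide

/-- `SB(cs) = 326` (native evaluation). [this work] -/
theorem SB_cs : cs.SB = 326 := by
  rw [SB_cs_eq]; native_decide

/-- `Ntri(cs) = 1302` (native evaluation). [this work] -/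
theorem Ntri_cs : cs.Ntri = 1302 := by
  rw [Ntri_cs_eq]; native_decide

/-- Both lemmas fail on the cyclic star, while the partition functional is positive: `3·SA − Ntri = −6`, `3·SB − Ntri = −324`, `ZH = 972`. [this work] -/
theorem cs_mixed : 3 * cs.SA - cs.Ntri = -6 ∧ 3 * cs.SB - cs.Ntri = -324 ∧ cs.ZH = 972 := by
  rw [cs.ZH_eq_SA_SB, SA_cs, SB_cs, Ntri_cs]
  norm_num

end CyclicStar

/-- **`PurePayer` is false** (computational; witness = the cyclic star `CS(3,3,3)` on nine coordinates: `Ntri = 1302 > 1296 = 3·max(SA, SB)`). [this work] -/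
theorem not_purePayer : ¬ PurePayer := by
  intro h
  have h1 := h (Fin 9) CyclicStar.cs
  rw [CyclicStar.SA_cs, CyclicStar.SB_cs, CyclicStar.Ntri_cs] at h1
  norm_num at h1

end Summit.CriticalPhenomena.PercolationContinuityZ3.Theorems.SunflowerPartition
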